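import Summits.BirchSwinnertonDyer.BirchSwinnertonDyer.Theorems.SignedLowerHalvesSmallImageLowerHalfBothSignsLambdaLowerThreeNsThetaPartnerOdd
import Summits.BirchSwinnertonDyer.BirchSwinnertonDyer.Theorems.SignedLowerHalvesSmallImageLowerHalfBothSignsLambdaLowerThreeNsThetaPartnerFixedField
import Summits.BirchSwinnertonDyer.BirchSwinnertonDyer.Theorems.SignedLowerHalvesSmallImageLowerHalfBothSignsLambdaLowerThreeNsThetaPartnerInertPlace
import Summits.BirchSwinnertonDyer.BirchSwinnertonDyer.Theorems.SignedLowerHalvesKobayashiMainConjectureSmallImageShadowInert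
import Summits.BirchSwinnertonDyer.BirchSwinnertonDyer.Theorems.SignedLowerHalvesSmallImageLowerHalfBothSignsLambdaLowerThreeNsThetaPartnerInertFieldData
import Literature.FieldTheory.AlgClosed.PadicAlgClEquivComplex
import Literature.NumberTheory.QuadraticFields.HeegnerCondition
import Literature.NumberTheory.EllipticCurves.SelmerCorankControlRatProofs
import HarnessLib

/-!
# K0₂@p WITHOUT ITS LEVEL CLAUSE from brick R6: every hypothesis of the odd-`p` assembly theorem is discharged on the
# class (composition of AH1a–c with the small-image datum), R6 itself displayed as a hypothesis

Route `SignedLowerHalves`, child L `SmallImageLowerHalfBothSigns` (item stmt-BirchSwinnertonDyer-23599), line `rtt_w3`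
(skeleton of record 93f5c6538fc2784e; v2 proposal `Lines/rtt_w3_v2.lean`), stub K0₂@p `stub_heckeThetaPartner_ns`
(width seat `bsd-line-slh-p3-w3` gen 10; memo `Lines/birth_acns-MEMO-w3-g10.md`).  THEOREMS ONLY (no definition, no named
fact, no `sorry`); ROUTE-INDEPENDENT (no `Theses` import).

WHY THIS FILE: the assembly theorem R6 `heckeThetaPartner_of_inertField` of gen 9 (`…ThetaPartnerAssembly`, proposal
p733453) is held in the gate's verify queue by a farm build backlog on its imports (`…ThetaPartnerOrientCFT`,
`…ThetaPartnerMatching`, accepted 15:4xZ, unbuilt for hours).  Its STATEMENT only mentions long-built vocabulary, so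
this file proves — now, in the kernel — that ALL ITS HYPOTHESES hold on the class: `heckeThetaPartner_sansLevel_of_R6`
takes the R6 statement as the displayed hypothesis `hR6` (a theorem statement, NOT a named fact) and concludes K0₂@p
without its level clause for every small-image X7 pair.  When R6 lands, `…ThetaPartnerSansLevel` is the one-line
specialisation `heckeThetaPartner_sansLevel_of_R6 heckeThetaPartner_of_inertField`.

The discharge (see the proof): frame `exists_frame_galoisRepTorsion_rat`; small-image datum
`smallImage_exists_imaginary_inert_index_two_subgroup_of_goodSS_of_not_surj` (non-split Cartan `kˣ`, `U = ρ̄⁻¹(kˣ)` open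
of index `2`, inertia above `p` / good / multiplicative places inside `U`, no complex conjugation, no Frobenius above `p`
in `U`); AH1a `exists_numberField_of_index_two` (`K = ℚ̄^U`: number field, Galois, totally complex, degree `2`,
`res(Γ_K) = U`, unramified where the inertia lies in `U`); AH1b `exists_place_asIdeal_eq_span` (`v = p𝓞_K`, `#𝓞K/v = p²`),
`natCast_dvd_of_mem_maximalIdeal`, `isUniformizer_natCast`, `residueFieldCard_eq_of_card_quotient`; AH1c
`nonempty_residueEmbedding`, `exists_frobenius_ringHom`, `not_dvd_discr_of_isUnramifiedIn` (at `p` and at every good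
prime dividing `d_K`); `Quadratic.exists_sq_eq_discr` / `discr_emod_four` / `NumberField.sign_discr` (`δ² = d_K < 0`,
`d_K ≡ 0,1 (4)`); `B = N_W` (`dvd_conductorNorm_iff_not_hasGoodReductionAtPrime`, `conductorNorm_pos_holds`);
`e : ℚ̄_p ≃ ℂ` (`PadicAlgCl.nonempty_ringEquiv_complex`); `σ = IsAlgClosed.lift : K → ℂ`.

BSD, crux L and the stub are NOT proved here; nothing is conditional on a named fact.

References: J.-P. Serre, Invent. Math. 15 (1972) §2, §4.2, §5.2 (iv); J. Neukirch, ANT I §8–§9, IV §1; E. Artin–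
O. Schreier 1927.
-/

set_option autoImplicit false
set_option linter.dupNamespace false

noncomputable section

open scoped Classical NumberField MatrixGroups nonZeroDivisors
open IsDedekindDomain IsDedekindDomain.HeightOneSpectrum Field Matrix NumberField WeierstrassCurve
  Literature.NumberTheory.EllipticCurves Literature.NumberTheory.GaloisRepresentations Rat.HeightOneSpectrum
  Literature.NumberTheory.EllipticCurves.Rank1Residual Summit.BirchSwinnertonDyer.Rank1Residual
  Literature.NumberTheory.LFunctions Literature.NumberTheory.GaloisRepresentations.HeckeCharacter
  Literature.NumberTheory.GaloisRepresentations.IsNonarchimedeanLocalField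
  Literature.NumberTheory.GaloisRepresentations.ModPGaloisRep ValuativeRel
  Literature.NumberTheory.EllipticCurves.ModularForms Literature.NumberTheory.Automorphic
  Summit.BirchSwinnertonDyer.BirchSwinnertonDyer.Theorems.HeckeThetaPartner

namespace Summit.BirchSwinnertonDyer.BirchSwinnertonDyer.Theorems.SmallImageLambdaLowerThreeNsThetaPartner

/-- **K0₂@p without its level clause, from brick R6.**  GIVEN the odd-`p` assembly statement `hR6` (= the statement
of `heckeThetaPartner_of_inertField`, gen 9), for `E = W/ℚ` globally minimal, `p ≠ 2`, `ClassX7 W p`, `ρ̄_{E,p}` not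
onto: a CM newform `g` of weight `2` on some `Γ₀(M)`, `p ∤ M`, all prime factors of `M` bad, `a_p(g) = 0`, a
cohomological plus period, and `a_ℓ(g) ≡ a_ℓ(E)` `p`-adically off `p·M·N_E`.  ALL hypotheses of `hR6` are discharged
here in the kernel (see the module docstring). [cite: Serre1972, §2.2 Prop. 14, §4.2 c), §5.2 (iv)]
[cite: NeukirchANT1999, Ch. I §8 (8.2), §9 (9.3)–(9.6), Ch. IV §1 (1.2)] -/
theorem heckeThetaPartner_sansLevel_of_R6
    (hR6 : ∀ (W : WeierstrassCurve ℚ) [W.IsElliptic] [W.IsGloballyMinimal] (p : ℕ) [Fact p.Prime]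
      (Φ : Multiplicative (AddAut (geomTorsion W p)) ≃* GL (Fin 2) (ZMod p))
      {k : Subalgebra (ZMod p) (Matrix (Fin 2) (Fin 2) (ZMod p))}
      (K : Type) [Field K] [NumberField K] [IsGalois ℚ K] [IsTotallyComplex K],
      p ≠ 2 → GoodSS W p →
      ∀ (e₀ : geomTorsion W p ≃+ (Fin 2 → ZMod p)),
      (∀ (g : Multiplicative (AddAut (geomTorsion W p))) (x : geomTorsion W p),
        e₀ (Multiplicative.toAdd g x) = ((Φ g : GL (Fin 2) (ZMod p)) : Matrix (Fin 2) (Fin 2) (ZMod p)) *ᵥ e₀ x) →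
      IsField k → Module.finrank (ZMod p) k = 2 →
      (letI : Module (ZMod p) (geomTorsion W p) := AddSubgroup.torsionBy.zmodModule
        ∀ g : Multiplicative (AddAut (geomTorsion W p)),
          Matrix.trace ((Φ g : GL (Fin 2) (ZMod p)) : Matrix (Fin 2) (Fin 2) (ZMod p)) =
            LinearMap.trace (ZMod p) (geomTorsion W p) ((Multiplicative.toAdd g).toAddMonoidHom.toZModLinearMap p)) →
      (galoisRepTorsion W p).range.map Φ.toMonoidHom ≤
        Subgroup.normalizer (Serre1972.unitGroup k : Set (GL (Fin 2) (ZMod p))) →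
      Module.finrank ℚ K = 2 →
      ((Serre1972.unitGroup k).comap Φ.toMonoidHom).comap (galoisRepTorsion W p) ≤
        (absGaloisRestrict ℚ K).toMonoidHom.range →
      (∀ τ : absoluteGaloisGroup K, Φ (galoisRepTorsion W p (absGaloisRestrict ℚ K τ)) ∈ Serre1972.unitGroup k) →
      ∀ {v : HeightOneSpectrum (𝓞 K)}, v.asIdeal = Ideal.span {(p : 𝓞 K)} →
      (∀ c ∈ IsLocalRing.maximalIdeal (v.adicCompletionIntegers K), ((p : ℕ) : v.adicCompletionIntegers K) ∣ c) →
      (valuation (v.adicCompletion K)).IsUniformizer ((p : ℕ) : v.adicCompletion K) →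
      residueFieldCard (v.adicCompletion K) = p ^ 2 → Nat.card (𝓞 K ⧸ v.asIdeal) = p ^ 2 →
      ∀ (ι : absIntegers 𝒪[v.adicCompletion K] (v.adicCompletion K) ⧸ absMaximalIdeal (v.adicCompletion K) →+*
          padicAlgClResidueField p)
        (c : K →+* K) (cO : 𝓞 K →+* 𝓞 K), (∀ b : 𝓞 K, ((cO b : 𝓞 K) : K) = c (b : K)) →
      (∀ b : 𝓞 K, cO b - b ^ p ∈ v.asIdeal) →
      ∀ {δ : 𝓞 K} {Δ : ℤ}, Δ < 0 → (δ : K) ^ 2 = (Δ : K) →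
      (NumberField.discr K % 4 = 0 ∨ NumberField.discr K % 4 = 1) → ¬ (p : ℤ) ∣ NumberField.discr K →
      (∀ (ℓ : ℕ) [Fact ℓ.Prime], (ℓ : ℤ) ∣ NumberField.discr K → ¬ W.HasGoodReductionAtPrime ℓ) →
      ∀ (B : ℕ), B ≠ 0 → ¬ p ∣ B → (∀ (ℓ : ℕ) [Fact ℓ.Prime], ℓ ∣ B → ¬ W.HasGoodReductionAtPrime ℓ) →
      (∀ (ℓ : ℕ) [Fact ℓ.Prime], ¬ W.HasGoodReductionAtPrime ℓ → ℓ ∣ B) →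
      ∀ (e : PadicAlgCl p ≃+* ℂ) (σ : K →+* ℂ),
      ∃ (M : ℕ) (_ : NeZero M) (g : CuspForm (CongruenceSubgroup.Gamma0 M) 2)
        (ιg : coeffField g →+* PadicAlgCl p) (Ω : ℂ),
        ¬ p ∣ M ∧ (∀ (ℓ : ℕ) [Fact ℓ.Prime], ℓ ∣ M → ¬ W.HasGoodReductionAtPrime ℓ) ∧ IsNewform0 g ∧
          IsCMForm (liftToGamma1 M 2 g) ∧ cuspCoeff g p = 0 ∧ IsCohomologicalPlusPeriod g ιg Ω ∧
          ∀ ℓ : ℕ, ℓ.Prime → ¬ ℓ ∣ p * M * W.conductorNorm ℤ →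
            ‖embCoeff g ιg ℓ - (W.frobeniusTrace ℓ : PadicAlgCl p)‖ < 1)
    (W : WeierstrassCurve ℚ) [W.IsElliptic] [W.IsGloballyMinimal] (p : ℕ) [Fact p.Prime]
    (hp2 : p ≠ 2) (hX : ClassX7 W p) (hs : ¬ Surj W p) :
    ∃ (M : ℕ) (_ : NeZero M) (g : CuspForm (CongruenceSubgroup.Gamma0 M) 2)
      (ιg : coeffField g →+* PadicAlgCl p) (Ω : ℂ),
      ¬ p ∣ M ∧ (∀ (ℓ : ℕ) [Fact ℓ.Prime], ℓ ∣ M → ¬ W.HasGoodReductionAtPrime ℓ) ∧ IsNewform0 g ∧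
        IsCMForm (liftToGamma1 M 2 g) ∧ cuspCoeff g p = 0 ∧ IsCohomologicalPlusPeriod g ιg Ω ∧
        ∀ ℓ : ℕ, ℓ.Prime → ¬ ℓ ∣ p * M * W.conductorNorm ℤ →
          ‖embCoeff g ιg ℓ - (W.frobeniusTrace ℓ : PadicAlgCl p)‖ < 1 := by
  classical
  have hp : p.Prime := Fact.out
  have hss : GoodSS W p := hX.1
  -- frame and small-image datum (Serre 1972 §2, §5.2 (iv); `…KobayashiMainConjectureSmallImageShadowInert`)
  obtain ⟨e₀, Φ, he₀, htr, -⟩ := exists_frame_galoisRepTorsion_rat W p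
  obtain ⟨k, hk, h2, hGN, hopen, hidx, hin, himag, hinert⟩ :=
    smallImage_exists_imaginary_inert_index_two_subgroup_of_goodSS_of_not_surj W p Φ e₀ he₀ hp2 hss hs
  set U : Subgroup (absoluteGaloisGroup ℚ) :=
    ((Serre1972.unitGroup k).comap Φ.toMonoidHom).comap (galoisRepTorsion W p) with hU
  -- AH1a: the dihedral field `K = ℚ̄^U`
  obtain ⟨K, _, _, hGal, htc, hK2, hrange, hunrK⟩ := exists_numberField_of_index_two U hopen hidx himag
  haveI := hGal
  haveI := htc
  have hUle : U ≤ (absGaloisRestrict ℚ K).toMonoidHom.range := by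
    intro x hx
    rw [← hrange] at hx
    obtain ⟨τ, hτ⟩ := hx
    exact ⟨τ, hτ⟩
  have hKU : ∀ τ : absoluteGaloisGroup K, Φ (galoisRepTorsion W p (absGaloisRestrict ℚ K τ)) ∈ Serre1972.unitGroup k := by
    intro τ
    have hτ : absGaloisRestrict ℚ K τ ∈ U := hrange ▸ ⟨τ, rfl⟩
    exact hτ
  -- the place of `ℚ` at `p`, unramified in `K`
  set v₀ : HeightOneSpectrum (𝓞 ℚ) := (primesEquiv (R := 𝓞 ℚ)).symm ⟨p, hp⟩ with hv₀
  have hpv₀' : natGenerator v₀ = p := congrArg Subtype.val ((primesEquiv (R := 𝓞 ℚ)).apply_symm_apply ⟨p, hp⟩)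
  have hpv₀ : (p : 𝓞 ℚ) ∈ v₀.asIdeal := (Rat.natCast_mem_asIdeal_iff v₀).mpr (hpv₀' ▸ dvd_rfl)
  have hunr : Algebra.IsUnramifiedIn (𝓞 K) v₀.asIdeal := hunrK v₀ fun 𝔓 h𝔓 => hin v₀ (Or.inl hpv₀) 𝔓 h𝔓
  -- AH1b: the inert place `v = p𝓞_K` and its local data
  obtain ⟨v, hvp, hcard⟩ := exists_place_asIdeal_eq_span K hK2 p hpv₀ hunr
    (fun 𝔓 h𝔓 => hrange.symm ▸ hin v₀ (Or.inl hpv₀) 𝔓 h𝔓)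
    (fun 𝔓 h𝔓 σ hσ => hrange.symm ▸ hinert v₀ hpv₀ 𝔓 h𝔓 σ hσ)
  have hgen := natCast_dvd_of_mem_maximalIdeal hvp
  have hπ := isUniformizer_natCast hvp
  have hq : residueFieldCard (v.adicCompletion K) = p ^ 2 := residueFieldCard_eq_of_card_quotient hcard
  -- AH1c: residue embedding, Frobenius, discriminant
  obtain ⟨ι⟩ := nonempty_residueEmbedding p v hq
  obtain ⟨c, cO, hcO, hc⟩ := exists_frobenius_ringHom K p hvp
  obtain ⟨t, m, δ, -, hδ⟩ := Literature.NumberTheory.QuadraticFields.Quadratic.exists_sq_eq_discr (K := K) hK2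
  have hδ' : (δ : K) ^ 2 = ((NumberField.discr K : ℤ) : K) := by
    have h := congrArg (algebraMap (𝓞 K) K) hδ
    rwa [map_pow, map_intCast] at h
  have hΔ : NumberField.discr K < 0 := by
    have h1 : InfinitePlace.nrComplexPlaces K = 1 := by
      have := IsTotallyComplex.finrank K
      omega
    have h := NumberField.sign_discr K
    rw [h1, pow_one] at h
    exact Int.sign_eq_neg_one_iff_neg.mp h
  have hd4 := Literature.NumberTheory.QuadraticFields.Quadratic.discr_emod_four (K := K) hK2
  have hpd : ¬ (p : ℤ) ∣ NumberField.discr K := not_dvd_discr_of_isUnramifiedIn K hp hpv₀ hunr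
  have hdK : ∀ (ℓ : ℕ) [Fact ℓ.Prime], (ℓ : ℤ) ∣ NumberField.discr K → ¬ W.HasGoodReductionAtPrime ℓ := by
    intro ℓ _ hℓd hgood
    have hℓ : ℓ.Prime := Fact.out
    set vℓ : HeightOneSpectrum (𝓞 ℚ) := (primesEquiv (R := 𝓞 ℚ)).symm ⟨ℓ, hℓ⟩ with hvℓ
    have hℓv' : natGenerator vℓ = ℓ := congrArg Subtype.val ((primesEquiv (R := 𝓞 ℚ)).apply_symm_apply ⟨ℓ, hℓ⟩)
    have hℓv : (ℓ : 𝓞 ℚ) ∈ vℓ.asIdeal := (Rat.natCast_mem_asIdeal_iff vℓ).mpr (hℓv' ▸ dvd_rfl)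
    have hgood' : W.HasGoodReductionAt vℓ := W.hasGoodReductionAt_of_hasGoodReductionAtPrime vℓ hℓv hgood
    have hunrℓ : Algebra.IsUnramifiedIn (𝓞 K) vℓ.asIdeal :=
      hunrK vℓ fun 𝔓 h𝔓 => hin vℓ (Or.inr (Or.inl hgood')) 𝔓 h𝔓
    exact not_dvd_discr_of_isUnramifiedIn K hℓ hℓv hunrℓ hℓd
  -- `B = N_W`
  have hB0 : W.conductorNorm ℤ ≠ 0 := (W.conductorNorm_pos_holds).ne'
  have hpB : ¬ p ∣ W.conductorNorm ℤ := fun h =>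
    (W.dvd_conductorNorm_iff_not_hasGoodReductionAtPrime p).mp h hX.1.1
  have hBbad : ∀ (ℓ : ℕ) [Fact ℓ.Prime], ℓ ∣ W.conductorNorm ℤ → ¬ W.HasGoodReductionAtPrime ℓ :=
    fun ℓ _ h => (W.dvd_conductorNorm_iff_not_hasGoodReductionAtPrime ℓ).mp h
  have hbadB : ∀ (ℓ : ℕ) [Fact ℓ.Prime], ¬ W.HasGoodReductionAtPrime ℓ → ℓ ∣ W.conductorNorm ℤ :=
    fun ℓ _ h => (W.dvd_conductorNorm_iff_not_hasGoodReductionAtPrime ℓ).mpr h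
  -- `e : ℚ̄_p ≃ ℂ`, `σ : K → ℂ`
  obtain ⟨e⟩ := PadicAlgCl.nonempty_ringEquiv_complex p
  let σ : K →+* ℂ := (IsAlgClosed.lift (R := ℚ) (M := ℂ) (S := K)).toRingHom
  exact hR6 W p Φ K hp2 hss e₀ he₀ hk h2 htr hGN hK2 hUle hKU hvp hgen hπ hq hcard ι c cO hcO hc hΔ hδ' hd4 hpd
    hdK (W.conductorNorm ℤ) hB0 hpB hBbad hbadB e σ

end Summit.BirchSwinnertonDyer.BirchSwinnertonDyer.Theorems.SmallImageLambdaLowerThreeNsThetaPartner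

end
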